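import Literature.MathematicalPhysics.QuantumLattice.FermionQuasiFreeTimeOrderedWick
import HarnessLib

/-!
# The thermal Wick theorem for a SPLIT-PAIR word: `⟨c(g₀) · u₀v₁⋯u_{K-1}v_K · u_K · u_{K+1}v_{K+1}⋯u_n v_n⟩` in determinant form

Topic `MathematicalPhysics/QuantumLattice`; continuation of `FermionQuasiFreeTimeOrderedWick.lean` (Gaudin's theorem for INTERLEAVED words
of linear letters, `gibbsState_dGamma_linWordOp_interleaveWord`).  The perturbation series of a two-point Schwinger function at UNEQUAL
imaginary times (Benfatto–Giuliani–Mastropietro 2006 §1.2 (1.3), §2.1 (2.8); two-time Dyson expansion `DysonTwoTimeGibbsWord` /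
`ShiftedHubbardTwoTimeDyson`) has, as free coefficients, the Gibbs expectations of the word «annihilation letter first (time `0`), `K` vertex
pairs, the creation letter (time `−(β−s)`), the remaining pairs» — an alternating pair word with the external pair SPLIT.  Here that word is
identified as an interleaving (data `splitPairK`: `k₀ = 0`, `k_{b+1} = b+1` for `b < K`, `b+2` for `b ≥ K`) and Gaudin's theorem is applied:

* `oneInsertionFactor`, `splitPairK` (bookkeeping defs); `linWordOp_interleaveWord_oneInsertion`, `linWordOp_interleaveWord_splitPair` — the
  word as `linWordOp (interleaveWord …)`;
* **`gibbsState_dGamma_splitPairWord_eq_sign_mul_det`** — `⟨c(g₀)·∏_i oneInsertionFactor⟩_{β,dΓ(h)} = interleaveSign(splitPairK) ·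
  det[ a < k_b ? ⟨c†(f_a)c(g_b)⟩ : −⟨c(g_b)c†(f_a)⟩ ]` (unshifted);
* `interleaveSign_splitPairK` (`= (−1)^{K+1}`), `splitPairMatrix` (rows rotated by `(Fin.cycleRange K)⁻¹` so that the split pair is index `0`;
  entries then follow the `propMatrix` before-rule on pair indices) and **`gibbsState_dGamma_splitPairWord_eq_neg_det`**:
  `⟨c(g₀)·∏_i oneInsertionFactor⟩ = −det (splitPairMatrix)`;
* the ENTRY TABLE `splitPairMatrix_zero_zero / _zero_succ / _succ_zero / _succ_succ`: `(0,0)` after-branch, `(0,m+1)` before iff `K ≤ m`,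
  `(m+1,0)` after-branch, `(m+1,m'+1)` the `propMatrix` rule `m ≤ m'` (the shifted / evolved-letter forms are the next step,
  HOME/hubbard-kl-k3c5-p1/H1-DESIGN.md §2).

Everything is PROVED; the two definitions are bookkeeping.

## References
* M. Gaudin, Nucl. Phys. 15 (1960) 89 (the thermal Wick theorem). [Gaudin1960]
* G. Benfatto, A. Giuliani, V. Mastropietro, Ann. Henri Poincaré 7 (2006) 809–898, §1.2 (1.3), §2.1 (2.8). [BenfattoGiulianiMastropietro2006]
-/

namespace Literature.MathematicalPhysics.QuantumLattice

open Matrix Finset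

variable {ι : Type*} [LinearOrder ι] [Fintype ι]

/-- The `i`-th factor of the one-insertion word (`K ≤ n`): the pair `u_i v_i` before the insertion point `K`, the lone creation letter
`u_K` at it, the pair `u_i v_{i-1}` after it. [folklore] -/
def oneInsertionFactor (K n : ℕ) (hK : K ≤ n) (u : Fin (n + 1) → LinLetter ι) (v : Fin n → LinLetter ι) (i : Fin (n + 1)) :
    Matrix (Finset ι) (Finset ι) ℂ :=
  if h : (i : ℕ) < K then linLetterOp (u i) * linLetterOp (v ⟨i, lt_of_lt_of_le h hK⟩)
  else if h' : (i : ℕ) = K then linLetterOp (u i)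
  else linLetterOp (u i) * linLetterOp (v ⟨(i : ℕ) - 1, by have := i.isLt; omega⟩)

/-- **The one-insertion interleaving** (`K ≤ n`): with `k_b = b + 1` for `b < K` and `k_b = b + 2` for `b ≥ K`,
`linWordOp (interleaveWord (n+1) n u v k) = ∏_i oneInsertionFactor K n u v i` — i.e. `u₀v₀⋯u_{K-1}v_{K-1}·u_K·u_{K+1}v_K⋯u_nv_{n-1}`.
[cite: BenfattoGiulianiMastropietro2006, §2.1 (2.8)] -/
theorem linWordOp_interleaveWord_oneInsertion :
    ∀ (K n : ℕ) (hK : K ≤ n) (u : Fin (n + 1) → LinLetter ι) (v : Fin n → LinLetter ι),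
      linWordOp (interleaveWord (n + 1) n u v fun b => if (b : ℕ) < K then (b : ℕ) + 1 else (b : ℕ) + 2) =
        (List.ofFn fun i : Fin (n + 1) => oneInsertionFactor K n hK u v i).prod
  | 0, n, hK, u, v => by
    rw [interleaveWord_consU u v (fun b => by simp), linWordOp_cons]
    have hk : (fun b : Fin n => (if (b : ℕ) < 0 then (b : ℕ) + 1 else (b : ℕ) + 2) - 1) = fun b : Fin n => (b : ℕ) + 1 := by
      funext b; simp
    rw [hk, linWordOp_interleaveWord_alternating, List.ofFn_succ, List.prod_cons]
    have h0 : oneInsertionFactor 0 n hK u v 0 = linLetterOp (u 0) := by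
      unfold oneInsertionFactor
      rw [dif_neg (by simp), dif_pos (by simp)]
    rw [h0]
    rfl
  | K + 1, 0, hK, u, v => absurd hK (by omega)
  | K + 1, n + 1, hK, u, v => by
    rw [interleaveWord_consU u v (fun b => by split_ifs <;> omega), linWordOp_cons]
    have hk0 : (fun b : Fin (n + 1) => (if (b : ℕ) < K + 1 then (b : ℕ) + 1 else (b : ℕ) + 2) - 1) 0 = 0 := by simp
    rw [interleaveWord_consV (Fin.tail u) v hk0, linWordOp_cons]
    have hk : Fin.tail (fun b : Fin (n + 1) => (if (b : ℕ) < K + 1 then (b : ℕ) + 1 else (b : ℕ) + 2) - 1) =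
        fun b : Fin n => if (b : ℕ) < K then (b : ℕ) + 1 else (b : ℕ) + 2 := by
      funext b
      simp only [Fin.tail, Fin.val_succ]
      split_ifs <;> omega
    rw [hk, linWordOp_interleaveWord_oneInsertion K n (by omega) (Fin.tail u) (Fin.tail v)]
    conv_rhs => rw [List.ofFn_succ, List.prod_cons]
    have h0 : oneInsertionFactor (K + 1) (n + 1) hK u v 0 = linLetterOp (u 0) * linLetterOp (v 0) := by
      unfold oneInsertionFactor
      rw [dif_pos (by simp)]
      rfl
    rw [h0, mul_assoc]
    congr 2
    refine congrArg List.prod (List.ofFn_inj.2 (funext fun i => ?_))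
    -- the `i`-th factor of the tail word is the `i.succ`-th factor of the big word
    unfold oneInsertionFactor
    simp only [Fin.tail, Fin.val_succ]
    by_cases h1 : (i : ℕ) < K
    · rw [dif_pos h1, dif_pos (by omega)]
      rfl
    · rw [dif_neg h1]
      by_cases h2 : (i : ℕ) = K
      · rw [dif_pos h2, dif_neg (by omega), dif_pos (by omega)]
      · rw [dif_neg h2, dif_neg (by omega), dif_neg (by omega)]
        congr 3
        exact Fin.ext (by simp; omega)

/-- The interleaving data of the FULL split-pair word (annihilation letter `v₀` first, then the one-insertion word): `k₀ = 0`,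
`k_{b+1} = b + 1` for `b < K`, `k_{b+1} = b + 2` for `b ≥ K`. [folklore] -/
def splitPairK (K n : ℕ) : Fin (n + 1) → ℕ :=
  Fin.cons 0 fun b : Fin n => if (b : ℕ) < K then (b : ℕ) + 1 else (b : ℕ) + 2

/-- `splitPairK` is monotone. [folklore] -/
private theorem monotone_splitPairK (K n : ℕ) : Monotone (splitPairK K n) := by
  intro a b hab
  induction a using Fin.cases with
  | zero => simp [splitPairK]
  | succ a =>
    induction b using Fin.cases with
    | zero => exact absurd (Fin.le_def.1 hab) (by simp)
    | succ b =>
      simp only [splitPairK, Fin.cons_succ]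
      have hab' : (a : ℕ) ≤ b := by have := Fin.le_def.1 hab; simpa using this
      split_ifs <;> omega

/-- `splitPairK K n b ≤ n + 1`. [folklore] -/
private theorem splitPairK_le (K n : ℕ) (b : Fin (n + 1)) : splitPairK K n b ≤ n + 1 := by
  induction b using Fin.cases with
  | zero => simp [splitPairK]
  | succ b =>
    simp only [splitPairK, Fin.cons_succ]
    have := b.isLt
    split_ifs <;> omega

/-- **The full split-pair word as an interleaving**: `c(g₀) · u₀v₁⋯ · u_K · ⋯` with `v = (g₀, g₁, …)`.
[cite: BenfattoGiulianiMastropietro2006, §2.1 (2.8)] -/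
theorem linWordOp_interleaveWord_splitPair (K n : ℕ) (hK : K ≤ n) (u : Fin (n + 1) → LinLetter ι) (v : Fin (n + 1) → LinLetter ι) :
    linWordOp (interleaveWord (n + 1) (n + 1) u v (splitPairK K n)) =
      linLetterOp (v 0) * (List.ofFn fun i : Fin (n + 1) => oneInsertionFactor K n hK u (Fin.tail v) i).prod := by
  rw [interleaveWord_consV u v (show splitPairK K n 0 = 0 by simp [splitPairK]), linWordOp_cons]
  have htail : Fin.tail (splitPairK K n) = fun b : Fin n => if (b : ℕ) < K then (b : ℕ) + 1 else (b : ℕ) + 2 := by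
    funext b; simp [splitPairK, Fin.tail]
  rw [htail, linWordOp_interleaveWord_oneInsertion K n hK u (Fin.tail v)]

/-- **Thermal Wick theorem for the split-pair word (unshifted), determinant form.**  For Hermitian `h`, real `β`, `K ≤ n`, creation
coefficient vectors `f : Fin (n+1) → ι → ℂ` (the `K` pair creations before the insertion, the inserted creation `f_K`, the pair creations after)
and annihilation vectors `g : Fin (n+1) → ι → ℂ` (`g₀` = the leading annihilation letter, then the pair annihilations):
`⟨c(g₀) · ∏_i oneInsertionFactor⟩ = interleaveSign (splitPairK K n) · det[ a < k_b ? ⟨c†(f_a)c(g_b)⟩ : −⟨c(g_b)c†(f_a)⟩ ]`. [cite: Gaudin1960] -/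
theorem gibbsState_dGamma_splitPairWord_eq_sign_mul_det {h : Matrix ι ι ℂ} (hh : h.IsHermitian) (β : ℝ) (K n : ℕ) (hK : K ≤ n)
    (f g : Fin (n + 1) → ι → ℂ) :
    gibbsState β (dGamma h)
        (linLetterOp (g 0, false) *
          (List.ofFn fun i : Fin (n + 1) =>
            oneInsertionFactor K n hK (fun a => (f a, true)) (Fin.tail fun b => (g b, false)) i).prod) =
      interleaveSign (splitPairK K n) *
        (Matrix.of fun a b : Fin (n + 1) =>
          if (a : ℕ) < splitPairK K n b then
            gibbsState β (dGamma h) (linLetterOp (f a, true) * linLetterOp (g b, false))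
          else -gibbsState β (dGamma h) (linLetterOp (g b, false) * linLetterOp (f a, true))).det := by
  rw [← gibbsState_dGamma_linWordOp_interleaveWord hh β f g (splitPairK K n) (monotone_splitPairK K n) (splitPairK_le K n),
    linWordOp_interleaveWord_splitPair K n hK]

/-- The sign of the split-pair interleaving: `(−1)^{Σ_b (k_b + b + 1)} = (−1)^{K+1}` (`K ≤ n`) — the fermionic time-ordering sign of
the two-time word. [cite: BenfattoGiulianiMastropietro2006, §1.2 (1.3)] -/
theorem interleaveSign_splitPairK (K n : ℕ) (hK : K ≤ n) : interleaveSign (splitPairK K n) = (-1) ^ (K + 1) := by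
  rw [interleaveSign, ← Finset.prod_pow_eq_pow_sum, Fin.prod_univ_succ]
  have h0 : ((-1 : ℂ)) ^ (splitPairK K n 0 + ((0 : Fin (n + 1)) : ℕ) + 1) = -1 := by simp [splitPairK]
  have hm : ∀ m : Fin n, ((-1 : ℂ)) ^ (splitPairK K n m.succ + ((m.succ : Fin (n + 1)) : ℕ) + 1) =
      -(if (m : ℕ) < K then (1 : ℂ) else -1) := by
    intro m
    simp only [splitPairK, Fin.cons_succ, Fin.val_succ]
    split_ifs with h
    · rw [show (m : ℕ) + 1 + ((m : ℕ) + 1) + 1 = 2 * ((m : ℕ) + 1) + 1 by ring, pow_succ, pow_mul]; norm_num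
    · rw [show (m : ℕ) + 2 + ((m : ℕ) + 1) + 1 = 2 * ((m : ℕ) + 2) by ring, pow_mul]; norm_num
  rw [h0, Finset.prod_congr rfl (fun m _ => hm m), Finset.prod_neg, Finset.prod_ite, Finset.prod_const_one, one_mul,
    Finset.prod_const, Finset.card_univ, Fintype.card_fin]
  -- `#{m : Fin n | ¬ m < K} = n − K`
  have hlt : (Finset.univ.filter fun m : Fin n => (m : ℕ) < K).card = K := by
    rw [Fin.card_filter_val_lt, Nat.min_eq_right hK]
  have hcard : (Finset.univ.filter fun m : Fin n => ¬ ((m : ℕ) < K)).card = n - K := by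
    have h := Finset.card_filter_add_card_filter_not (s := (Finset.univ : Finset (Fin n))) (fun m : Fin n => (m : ℕ) < K)
    rw [hlt, Finset.card_univ, Fintype.card_fin] at h
    omega
  rw [hcard]
  -- parity bookkeeping: `−1 · (−1)^n · (−1)^{n−K} = (−1)^{K+1}`
  have hn2 : ((-1 : ℂ) ^ n) * ((-1 : ℂ) ^ n) = 1 := by rw [← pow_add, ← two_mul, pow_mul]; norm_num
  have hK2 : ((-1 : ℂ) ^ K) * ((-1 : ℂ) ^ K) = 1 := by rw [← pow_add, ← two_mul, pow_mul]; norm_num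
  have e1 : ((-1 : ℂ)) ^ (n - K) * (-1) ^ K = (-1) ^ n := by rw [← pow_add, Nat.sub_add_cancel hK]
  have e2 : ((-1 : ℂ)) ^ (n - K) = (-1) ^ n * (-1) ^ K := by
    calc ((-1 : ℂ)) ^ (n - K) = (-1) ^ (n - K) * ((-1) ^ K * (-1) ^ K) := by rw [hK2, mul_one]
      _ = ((-1) ^ (n - K) * (-1) ^ K) * (-1) ^ K := by ring
      _ = (-1) ^ n * (-1) ^ K := by rw [e1]
  rw [e2, pow_succ]
  linear_combination ((-1 : ℂ) ^ K * (-1)) * hn2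


/-- **The split-pair word matrix** (rows re-indexed so that the split pair sits at index `0`): row `0` = the inserted creation letter `f_K`,
row `m+1` = the creation letter of pair `m` (word position `K.succAbove m`); column `0` = the leading annihilation letter `g₀`, column `m+1` =
the annihilation letter of pair `m`; entries by the before-rule of Gaudin's theorem. [folklore] -/
noncomputable def splitPairMatrix (β : ℝ) (h : Matrix ι ι ℂ) (K n : ℕ) (hK : K ≤ n) (f g : Fin (n + 1) → ι → ℂ) :
    Matrix (Fin (n + 1)) (Fin (n + 1)) ℂ :=
  Matrix.of fun i b : Fin (n + 1) =>
    if (((Fin.cycleRange (⟨K, Nat.lt_succ_of_le hK⟩ : Fin (n + 1))).symm i : Fin (n + 1)) : ℕ) < splitPairK K n b then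
      gibbsState β (dGamma h) (linLetterOp (f ((Fin.cycleRange (⟨K, Nat.lt_succ_of_le hK⟩ : Fin (n + 1))).symm i), true) *
        linLetterOp (g b, false))
    else -gibbsState β (dGamma h) (linLetterOp (g b, false) *
        linLetterOp (f ((Fin.cycleRange (⟨K, Nat.lt_succ_of_le hK⟩ : Fin (n + 1))).symm i), true))

/-- **Thermal Wick theorem for the split-pair word, `−det` form**: `⟨c(g₀)·∏_i oneInsertionFactor⟩ = −det (splitPairMatrix)` (the sign
`(−1)^{K+1}` of the interleaving against the sign `(−1)^K` of the row rotation). [cite: Gaudin1960] -/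
theorem gibbsState_dGamma_splitPairWord_eq_neg_det {h : Matrix ι ι ℂ} (hh : h.IsHermitian) (β : ℝ) (K n : ℕ) (hK : K ≤ n)
    (f g : Fin (n + 1) → ι → ℂ) :
    gibbsState β (dGamma h)
        (linLetterOp (g 0, false) *
          (List.ofFn fun i : Fin (n + 1) =>
            oneInsertionFactor K n hK (fun a => (f a, true)) (Fin.tail fun b => (g b, false)) i).prod) =
      -(splitPairMatrix β h K n hK f g).det := by
  rw [gibbsState_dGamma_splitPairWord_eq_sign_mul_det hh β K n hK f g, interleaveSign_splitPairK K n hK]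
  set σ : Equiv.Perm (Fin (n + 1)) := (Fin.cycleRange (⟨K, Nat.lt_succ_of_le hK⟩ : Fin (n + 1))).symm with hσ
  set N : Matrix (Fin (n + 1)) (Fin (n + 1)) ℂ := Matrix.of fun a b : Fin (n + 1) =>
    if (a : ℕ) < splitPairK K n b then gibbsState β (dGamma h) (linLetterOp (f a, true) * linLetterOp (g b, false))
    else -gibbsState β (dGamma h) (linLetterOp (g b, false) * linLetterOp (f a, true)) with hN
  have hsub : splitPairMatrix β h K n hK f g = N.submatrix σ id := by
    ext i b; rfl
  have hsign : ((Equiv.Perm.sign σ : ℤ) : ℂ) = (-1) ^ K := by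
    rw [hσ, show (Fin.cycleRange (⟨K, Nat.lt_succ_of_le hK⟩ : Fin (n + 1))).symm =
      (Fin.cycleRange (⟨K, Nat.lt_succ_of_le hK⟩ : Fin (n + 1)))⁻¹ from rfl, Equiv.Perm.sign_inv, Fin.sign_cycleRange]
    push_cast
    rfl
  rw [hsub, Matrix.det_permute, hsign, pow_succ]
  ring

section EntryTable

variable (β : ℝ) (h : Matrix ι ι ℂ) (K n : ℕ) (hK : K ≤ n) (f g : Fin (n + 1) → ι → ℂ)

/-- The value of the succAbove position as a natural number: `K.succAbove m = m` if `m < K`, `m + 1` otherwise. [folklore] -/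
private theorem val_succAbove_eq (m : Fin n) :
    (((⟨K, Nat.lt_succ_of_le hK⟩ : Fin (n + 1)).succAbove m : Fin (n + 1)) : ℕ) = if (m : ℕ) < K then (m : ℕ) else (m : ℕ) + 1 := by
  split_ifs with hm
  · rw [Fin.succAbove_of_castSucc_lt _ _ (by rw [Fin.lt_def]; simpa using hm), Fin.val_castSucc]
  · rw [Fin.succAbove_of_le_castSucc _ _ (by rw [Fin.le_def]; simpa using Nat.le_of_not_lt hm), Fin.val_succ]

/-- Entry `(0,0)` of the split-pair matrix: the inserted creation letter comes AFTER the leading annihilation letter —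
`−⟨c(g₀) c†(f_K)⟩`. [cite: BenfattoGiulianiMastropietro2006, §1.2 (1.3)] -/
theorem splitPairMatrix_zero_zero :
    splitPairMatrix β h K n hK f g 0 0 = -gibbsState β (dGamma h) (linLetterOp (g 0, false) * linLetterOp (f ⟨K, Nat.lt_succ_of_le hK⟩, true)) := by
  simp [splitPairMatrix, splitPairK, Fin.cycleRange_symm_zero]

/-- Entries `(0, m+1)`: the inserted creation letter precedes the annihilation letter of pair `m` iff `K ≤ m`. [cite: BenfattoGiulianiMastropietro2006, §1.2 (1.3)] -/
theorem splitPairMatrix_zero_succ (m : Fin n) :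
    splitPairMatrix β h K n hK f g 0 m.succ =
      if K ≤ (m : ℕ) then gibbsState β (dGamma h) (linLetterOp (f ⟨K, Nat.lt_succ_of_le hK⟩, true) * linLetterOp (g m.succ, false))
      else -gibbsState β (dGamma h) (linLetterOp (g m.succ, false) * linLetterOp (f ⟨K, Nat.lt_succ_of_le hK⟩, true)) := by
  simp only [splitPairMatrix, splitPairK, Matrix.of_apply, Fin.cycleRange_symm_zero, Fin.cons_succ, Fin.val_mk]
  by_cases hm : K ≤ (m : ℕ)
  · have h1 : ¬ ((m : ℕ) < K) := by omega
    have h2 : K < (m : ℕ) + 2 := by omega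
    simp only [h1, if_false, h2, if_true, hm]
  · have h1 : (m : ℕ) < K := by omega
    have h2 : ¬ (K < (m : ℕ) + 1) := by omega
    simp only [h1, if_true, h2, if_false, hm]

/-- Entries `(m+1, 0)`: every pair creation letter comes after the leading annihilation letter — `−⟨c(g₀) c†(f_{K.succAbove m})⟩`. [cite: BenfattoGiulianiMastropietro2006, §1.2 (1.3)] -/
theorem splitPairMatrix_succ_zero (m : Fin n) :
    splitPairMatrix β h K n hK f g m.succ 0 =
      -gibbsState β (dGamma h) (linLetterOp (g 0, false) *
        linLetterOp (f ((⟨K, Nat.lt_succ_of_le hK⟩ : Fin (n + 1)).succAbove m), true)) := by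
  simp [splitPairMatrix, splitPairK, Fin.cycleRange_symm_succ]

/-- Entries `(m+1, m'+1)`: the `propMatrix` rule on pair indices — creation of pair `m` precedes annihilation of pair `m'` iff `m ≤ m'`.
[cite: BenfattoGiulianiMastropietro2006, §1.2 (1.3)] -/
theorem splitPairMatrix_succ_succ (m m' : Fin n) :
    splitPairMatrix β h K n hK f g m.succ m'.succ =
      if m ≤ m' then gibbsState β (dGamma h) (linLetterOp (f ((⟨K, Nat.lt_succ_of_le hK⟩ : Fin (n + 1)).succAbove m), true) *
          linLetterOp (g m'.succ, false))
      else -gibbsState β (dGamma h) (linLetterOp (g m'.succ, false) *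
          linLetterOp (f ((⟨K, Nat.lt_succ_of_le hK⟩ : Fin (n + 1)).succAbove m), true)) := by
  simp only [splitPairMatrix, splitPairK, Matrix.of_apply, Fin.cycleRange_symm_succ, Fin.cons_succ]
  rw [val_succAbove_eq K n hK m]
  have hmm : m ≤ m' ↔ (m : ℕ) ≤ m' := Fin.le_def
  by_cases hle : m ≤ m'
  · rw [if_pos hle, if_pos]
    have := hmm.1 hle
    split_ifs <;> omega
  · rw [if_neg hle, if_neg]
    have : ¬ ((m : ℕ) ≤ m') := fun h' => hle (hmm.2 h')
    split_ifs <;> omega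

end EntryTable

end Literature.MathematicalPhysics.QuantumLattice
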